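import Literature.AlgebraicGeometry.ShimuraVarieties.UnitaryBallQuotientDatum
import Literature.AlgebraicGeometry.HodgeTheory.ClassesSupportedOn
import Literature.AlgebraicGeometry.HodgeTheory.SupportedClassesRationalProofs
import Literature.LinearAlgebra.Matrix.SubfieldEntries
import HarnessLib

/-!
# Special cycle classes `SC^{2k}(S) ⊗ ℂ` on a compact arithmetic ball quotient `S = Γ \ 𝔹ᵖ`

Bergeron–Millson–Moeglin (BMM), *The Hodge conjecture and arithmetic quotients of complex balls*,
Acta Math. 216 (2016) = arXiv:1306.1515 (locators below follow the arXiv version: Introduction,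
then Parts 1–3 with their own section numbers, as in the companion file
`ShimuraVarieties/UnitaryBallQuotientDatum`), Introduction §1.7: "We may associate to an
`n`-dimensional totally positive Hermitian subspace of `V` a special cycle of complex codimension
`nq` in `S` which is Shimura subvariety associated to a unitary group of type `U(p-n, q)` at
infinity"; Part 2 §§3.1–3.3: for `U ⊆ V` totally positive definite, `H = U(U^⊥)`, `X_H ⊆ X` the
negative lines lying in `U^⊥`, and the CONNECTED CYCLE `c(U, g, K)` = the image of the totally
geodesic immersion `Γ_U \ X_H → Γ \ X` (for `K` neat); these are Kudla–Millson's special cycles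
"of definite type" `C_U = Γ_U \ D_U`, `D_U = {Z ∈ D : Z ⊆ U^⊥}` (Kudla–Millson 1990, §2,
pp. 129–131). For `q = 1` (the ball) and `dim U = k` the cycle `c(U)` is a closed algebraic
subvariety of `S(Γ)` of codimension `k`, itself a ball quotient for `U(p-k, 1)`.

## What this file defines

For a `ℂ`-scheme `X` carrying `D : UnitaryBallQuotientDatum p X` (an identification
`X(ℂ) ≅ Γ \ 𝔹ᵖ`, which records for every totally positive definite `E`-subspace `W ⊆ V = E^{p+1}`
the special subvariety `D.specialSubvariety W ⊆ X` — Zariski closed, with complex points the image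
of the sub-ball `𝔹(W^⊥)`, of codimension `≥ dim_E W` at each of its points):

* `specialCycleClasses D k : Submodule ℂ H²ᵏ(X(ℂ); ℂ)` — **the complex span of the classes of the
  special cycles of codimension `k`**: the supremum, over the totally positive definite `W ⊆ V`
  with `dim_E W = k`, of the classes supported on `D.specialSubvariety W`
  (`HodgeTheory.classesSupportedOn X Z (2k) = ker (H²ᵏ(X(ℂ)) → H²ᵏ((X ∖ Z)(ℂ)))`).

Why this is the span of the cycle classes `cl(c(W))` (no cycle-class MAP is needed, exactly as for
the tree's `HodgeTheory.algebraicClasses`): for `Z ⊆ X` irreducible, Zariski closed of codimension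
`k` in the smooth projective `p`-fold `X`, `ker (H²ᵏ(X(ℂ)) → H²ᵏ((X ∖ Z)(ℂ))) = im H²ᵏ_Z(X(ℂ))` and
`H²ᵏ_Z(X(ℂ); ℂ) ≅ H^{BM}_{2p-2k}(Z(ℂ); ℂ) = ℂ · [Z]` (Fulton 1998, §19.1 eq. (1) and Lemma 19.1.1),
whose image is `ℂ · cl(Z)`; and `c(W)` is irreducible (image of the ball `𝔹(W^⊥)`) of codimension
`k = dim W`. Summing over `W` gives `Σ_W ℂ · cl(c(W))`. All `Γ`-translates `γW` give the same
cycle, so indexing by subspaces rather than `Γ`-orbits changes nothing.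

## Relation to BMM's `SC^{2k}(S)` and to Kudla's weighted cycles

BMM (Part 2 §§3.4–3.5, following Kudla 1997) work with the WEIGHTED cycles
`Z(β, φ, K) = Σⱼ Σ_{x ∈ Ω_β(F) mod Γ'_{gⱼ}} φ(gⱼ⁻¹ x) c(U(x), gⱼ, K)` (`β ≫ 0` an `n × n` hermitian
matrix, `φ` a `K`-invariant Schwartz function), finite `ℚ`-combinations of connected cycles, and
let `SC^{2nq}(S) ⊆ H^{2nq}(S, ℚ)` be the span of the classes `[β, φ] = L^{q(n-t)} [Z(β, φ)]` over all
positive SEMI-definite `β ≥ 0` of rank `t` (`L` = Lefschetz operator of the canonical Kähler class);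
Theorem 67 of Part 2 (`thm:MainSC`; announced in Introduction §1.7):
`SC^•(S) = ⊕ₙ SC^{2nq}(S)` is a subring of `H^•(S, ℚ)` and
`SC^{2nq}(S) ⊆ SH^{nq,nq}(S, ℂ) ∩ H^{2nq}(S, ℚ)`.
On a fixed connected `S(Γ)` and for DEFINITE `β` (`t = n`), the classes `[Z(β, φ)]` and the classes
`[c(W)]`, `W` totally positive definite of dimension `n`, have the same `ℂ`-span (each `Z(β,φ)` is a
combination of `c(U(x))`'s; conversely `c(W) = c(U(x))` for a basis `x` of `W`, singled out by a
`φ` supported near `x`). So `specialCycleClasses D k` is the complexification of the DEFINITE-TYPE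
part of BMM's `SC^{2k}(S(Γ))` (`q = 1`); BMM's full `SC^{2k}` is
`Σ_{t ≤ k} L^{k-t} (definite-type span in degree 2t)`, which additionally needs the Kähler class and
is NOT defined here (the requesting route multiplies by `(1,1)`-classes itself).

## API

* `classesSupportedOn_specialSubvariety_le_specialCycleClasses` — the generators;
  `specialCycleClasses_le_iff` — how to bound the span;
* `specialCycleClasses_le_supportedClasses` / `specialCycleClasses_le_algebraicClasses` — special
  cycle classes are algebraic classes, `SC^{2k} ⊗ ℂ ≤ Nᵏ H²ᵏ = algebraicClasses X k` (the special
  subvarieties are closed of codimension `≥ k`; BMM Part 2 §3.2: "`Z(U, g, K)` [is an] algebraic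
  cycle");
* `specialCycleClasses_eq_span_isRationalClass` — `SC^{2k} ⊗ ℂ` is defined over `ℚ`: it is the
  complex span of its rational classes (BMM Part 2 §3.5: "The subspace `SC^{2nq}` is defined over
  `ℚ`"; here from the tree's proved `span_isRationalClass_eq_top_of_isSmoothProjective_holds`,
  `X` being smooth projective by `D.isSmoothProjective`);
* `specialCycleClasses_zero` — `SC⁰ ⊗ ℂ = H⁰(X(ℂ); ℂ)` (the special subvariety of `W = 0` is all of
  `X`; sanity check that the definition is not trivially `⊥`);
* `UnitaryBallUniformisationDatum.finrank_le_of_isTotallyPositive` — a totally positive definite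
  `W ⊆ V` has `dim_E W ≤ p` (BMM Part 2 §3.1: "as a sub-Hermitian space `U ⊂ V` is totally positive
  definite of dimension `t`. In particular: `0 ≤ t ≤ p`"; here: `V_{τ₁}` has signature `(p, 1)`, so
  its negative cone is a nonempty open set — `cone_nonempty`, the last vector of a Sylvester frame —
  and it meets the dense subset `τ₁(E)^{p+1}` — `exists_re_hermForm_neg`, `τ₁(E)` being dense in
  `ℂ` as `E` is CM); hence `specialCycleClasses_eq_bot_of_lt` — `SC^{2k} ⊗ ℂ = 0` for `k > p`
  (BMM Introduction §1.7: `SC^•(S) = ⊕_{n=0}^{p} SC^{2nq}(S)`) — and its `p = 2` instance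
  `specialCycleClasses_eq_bot_of_two_lt` (the lit-hodgefound Layer-C validation theorem V-C3.ii /
  V-C4.ii: a `(2,1)`-form has no totally positive definite `3`-space).

NOT here: the Hodge-type clause `SC^{2k} ⊆ H^{k,k}` of Theorem 67 (it needs a Hodge model of `X`;
for algebraic classes it is the tree's `Grothendieck1969_supportedClasses_le_hodgeConiveau`
circle of facts), the ring structure, Hecke operators, the adelic `Sh_K(G, X)`.

## References

* [BergeronMillsonMoeglin2016Balls] N. Bergeron, J. Millson, C. Moeglin, *The Hodge conjecture and
  arithmetic quotients of complex balls*, Acta Math. 216 (2016) 1–125, arXiv:1306.1515: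
  Introduction §§1.2, 1.7; Part 2 §§3.1–3.5 and Theorem 67 (`thm:MainSC`).
* [KudlaMillson1990] S. Kudla, J. Millson, *Intersection numbers of cycles on locally symmetric
  spaces and Fourier coefficients of holomorphic modular forms in several complex variables*,
  Publ. Math. IHÉS 71 (1990), §2, pp. 129–131 (special cycles `C_U`, definite type).
* [Kudla1997] S. Kudla, *Algebraic cycles on Shimura varieties of orthogonal type*, Duke Math. J. 86
  (1997) (weighted cycles `Z(β, φ, K)`).
* [Fulton1998] W. Fulton, *Intersection Theory*, 2nd ed. (1998), §19.1, Lemma 19.1.1.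
-/

noncomputable section

open CategoryTheory AlgebraicGeometry

namespace Literature.AlgebraicGeometry.ShimuraVarieties

open Literature.AlgebraicGeometry.Motives (SchemeOver ComplexPoints IsSmoothProjective)
open Literature.AlgebraicGeometry.HodgeTheory

variable {p : ℕ} {X : SchemeOver ℂ}

/-- The **special cycle classes of codimension `k`** on the ball quotient `X(ℂ) ≅ Γ \ 𝔹ᵖ` presented
by `D`: the complex subspace `SC^{2k}(S) ⊗ ℂ ⊆ H²ᵏ(X(ℂ); ℂ)` spanned by the classes of the special
cycles `c(W) = image of Γ_W \ 𝔹(W^⊥)` (a Shimura subvariety for `U(W^⊥) ≅ U(p-k, 1)`, closed of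
codimension `k`), `W ⊆ V = E^{p+1}` ranging over the totally positive definite `E`-subspaces of
dimension `k` (BMM Introduction §1.7, Part 2 §3.3; Kudla–Millson's cycles of definite type).
Rendered without a cycle-class map as `⨆_W` of the classes supported on the special subvariety
`D.specialSubvariety W` (`= ℂ · cl(c(W))` by `H²ᵏ_Z(X) ≅ H^{BM}_{2p-2k}(Z(ℂ)) = ℂ · [Z]` for `Z`
irreducible closed of codimension `k`, Fulton 1998 Lemma 19.1.1); see the module docstring for the
comparison with BMM's weighted classes `[β, φ]` (same span for definite `β`; the Lefschetz shifts
of lower special classes that BMM also put into `SC^{2k}` are not included).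
[cite: BergeronMillsonMoeglin2016Balls, Introduction §1.7 and Part 2 §§3.3–3.5] -/
def specialCycleClasses (D : UnitaryBallQuotientDatum p X) (k : ℕ) :
    Submodule ℂ (complexBetti X (2 * k)) :=
  ⨆ (W : Submodule D.E (Fin (p + 1) → D.E)) (_ : IsTotallyPositive (conjRingHom D.E) D.H W)
    (_ : Module.finrank D.E W = k), classesSupportedOn X (D.specialSubvariety W) (2 * k)

variable (D : UnitaryBallQuotientDatum p X)

/-- Unfolding of `specialCycleClasses`: the supremum over totally positive definite `W ⊆ V` of
dimension `k` of the classes supported on the special subvariety of `W`.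
[cite: BergeronMillsonMoeglin2016Balls, Introduction §1.7] -/
theorem specialCycleClasses_def (k : ℕ) :
    specialCycleClasses D k =
      ⨆ (W : Submodule D.E (Fin (p + 1) → D.E)) (_ : IsTotallyPositive (conjRingHom D.E) D.H W)
        (_ : Module.finrank D.E W = k), classesSupportedOn X (D.specialSubvariety W) (2 * k) :=
  rfl

/-- **Generators**: every class supported on the special subvariety `c(W)` of a totally positive
definite `W` of dimension `k` (in particular its cycle class `cl(c(W))`) is a special cycle class of
codimension `k`. [cite: BergeronMillsonMoeglin2016Balls, Part 2 §3.3] -/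
theorem classesSupportedOn_specialSubvariety_le_specialCycleClasses
    {W : Submodule D.E (Fin (p + 1) → D.E)} (hW : IsTotallyPositive (conjRingHom D.E) D.H W)
    {k : ℕ} (hk : Module.finrank D.E W = k) :
    classesSupportedOn X (D.specialSubvariety W) (2 * k) ≤ specialCycleClasses D k :=
  le_iSup_of_le W (le_iSup_of_le hW (le_iSup_of_le hk le_rfl))

/-- A class whose restriction to `(X ∖ c(W))(ℂ)` vanishes, `W` totally positive definite of
dimension `k`, is a special cycle class of codimension `k`.
[cite: BergeronMillsonMoeglin2016Balls, Part 2 §3.3] -/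
theorem mem_specialCycleClasses_of_restrictCompl_eq_zero
    {W : Submodule D.E (Fin (p + 1) → D.E)} (hW : IsTotallyPositive (conjRingHom D.E) D.H W)
    {k : ℕ} (hk : Module.finrank D.E W = k) {x : complexBetti X (2 * k)}
    (hx : complexBetti.restrictCompl X (D.specialSubvariety W) (2 * k) x = 0) :
    x ∈ specialCycleClasses D k :=
  classesSupportedOn_specialSubvariety_le_specialCycleClasses D hW hk
    (mem_classesSupportedOn_iff.mpr hx)

/-- **Bounding the span**: `SC^{2k} ⊗ ℂ ≤ S` iff `S` contains the classes supported on every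
special subvariety `c(W)`, `W` totally positive definite of dimension `k`.
[cite: BergeronMillsonMoeglin2016Balls, Introduction §1.7] -/
theorem specialCycleClasses_le_iff {k : ℕ} {S : Submodule ℂ (complexBetti X (2 * k))} :
    specialCycleClasses D k ≤ S ↔
      ∀ W : Submodule D.E (Fin (p + 1) → D.E), IsTotallyPositive (conjRingHom D.E) D.H W →
        Module.finrank D.E W = k → classesSupportedOn X (D.specialSubvariety W) (2 * k) ≤ S := by
  simp only [specialCycleClasses, iSup_le_iff]

/-- **Special cycle classes are supported in codimension `≥ k`**: `SC^{2k} ⊗ ℂ ≤ Nᵏ H²ᵏ(X(ℂ); ℂ)`,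
since each special subvariety `c(W)`, `dim W = k`, is Zariski closed of codimension `≥ k`
(fields `isClosed_specialSubvariety`, `le_coheight_of_mem_specialSubvariety` of the datum; BMM
Part 2 §3.2: the `Z(U, g, K)` are algebraic cycles, of codimension `dim U` for `q = 1`).
[cite: BergeronMillsonMoeglin2016Balls, Part 2 §§3.2–3.3] -/
theorem specialCycleClasses_le_supportedClasses (k : ℕ) :
    specialCycleClasses D k ≤ supportedClasses X (2 * k) k :=
  (specialCycleClasses_le_iff D).2 fun W hW hk ↦ by
    subst hk
    exact classesSupportedOn_le_supportedClasses (D.isClosed_specialSubvariety W hW)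
      (D.le_coheight_of_mem_specialSubvariety W hW) _

/-- **Special cycle classes are algebraic classes**: `SC^{2k}(S) ⊗ ℂ ≤ algebraicClasses X k`, the
complex span of the cycle classes of codimension-`k` subvarieties (special cycles are closed
algebraic subvarieties of codimension `k`; BMM Introduction §1.3 and Part 2 §3.2).
[cite: BergeronMillsonMoeglin2016Balls, Introduction §1.3 and Part 2 §3.2] -/
theorem specialCycleClasses_le_algebraicClasses (k : ℕ) :
    specialCycleClasses D k ≤ algebraicClasses X k :=
  specialCycleClasses_le_supportedClasses D k

/-- **`SC^{2k} ⊗ ℂ` is defined over `ℚ`**: it is contained in (hence equal to,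
`specialCycleClasses_eq_span_isRationalClass`) the complex span of its rational classes — each
generating kernel `ker (H²ᵏ(X(ℂ)) → H²ᵏ((X ∖ c(W))(ℂ)))` is spanned by its rational classes, `X`
being smooth projective (`D.isSmoothProjective` and the tree's proved
`span_isRationalClass_eq_top_of_isSmoothProjective_holds`). BMM Part 2 §3.5: "The subspace
`SC^{2nq}(Sh(G, X))` is defined over `ℚ`". [cite: BergeronMillsonMoeglin2016Balls, Part 2 §3.5] -/
theorem specialCycleClasses_le_span_isRationalClass (k : ℕ) :
    specialCycleClasses D k ≤ Submodule.span ℂ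
      {c : complexBetti X (2 * k) | IsRationalClass c ∧ c ∈ specialCycleClasses D k} := by
  refine (specialCycleClasses_le_iff D).2 fun W hW hk ↦ ?_
  refine (span_isRationalClass_eq_top_of_isSmoothProjective_holds.ker_restrictCompl_le_span
    D.isSmoothProjective (D.specialSubvariety W) (2 * k)).trans (Submodule.span_mono fun c hc ↦ ?_)
  exact ⟨hc.1, mem_specialCycleClasses_of_restrictCompl_eq_zero D hW hk hc.2⟩

/-- **`SC^{2k} ⊗ ℂ` is the complex span of its rational classes** (`= (SC^{2k} ⊗ ℂ ∩ H²ᵏ(X; ℚ)) ⊗ ℂ`: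
BMM's `SC^{2nq}(S) ⊆ H^{2nq}(S, ℚ)`, Part 2 §3.5 and Theorem 67 (2)).
[cite: BergeronMillsonMoeglin2016Balls, Part 2 §3.5 and Theorem 67] -/
theorem specialCycleClasses_eq_span_isRationalClass (k : ℕ) :
    specialCycleClasses D k = Submodule.span ℂ
      {c : complexBetti X (2 * k) | IsRationalClass c ∧ c ∈ specialCycleClasses D k} :=
  le_antisymm (specialCycleClasses_le_span_isRationalClass D k)
    (Submodule.span_le.2 fun _ hc ↦ hc.2)

/-- **`SC⁰ ⊗ ℂ = H⁰(X(ℂ); ℂ)`**: the zero subspace is (vacuously) totally positive definite of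
dimension `0`, its special subvariety contains every complex point of `X`
(`UnitaryBallQuotientDatum.pt_mem_specialSubvariety_bot`: the sub-ball of `W = 0` is the whole
ball), so the complement has no complex points and every degree-`0` class is supported on it
(BMM Part 2 §3.5, `n = 0`: `SC⁰` is spanned by the fundamental class).
[cite: BergeronMillsonMoeglin2016Balls, Part 2 §3.5] -/
theorem specialCycleClasses_zero : specialCycleClasses D 0 = ⊤ := by
  refine eq_top_iff.2 (le_trans (fun x _ ↦ ?_)
    (classesSupportedOn_specialSubvariety_le_specialCycleClasses D (W := ⊥)
      (fun w hw hne ↦ (hne ((Submodule.mem_bot D.E).1 hw)).elim) (finrank_bot D.E _)))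
  rw [mem_classesSupportedOn_iff]
  haveI : IsEmpty (Motives.complexPointsCompl X (D.specialSubvariety ⊥)) :=
    ⟨fun P ↦ P.2 (D.pt_mem_specialSubvariety_bot P.1)⟩
  haveI := ModuleCat.subsingleton_of_isZero
    (Motives.isZero_singularCohomology_of_isEmpty ℂ ℂ
      (E := Motives.complexPointsCompl X (D.specialSubvariety ⊥)) (2 * 0))
  exact Subsingleton.elim _ _

/-! ### No special cycles above the signature bound: `SC^{2k} ⊗ ℂ = 0` for `k > p` -/

open scoped Matrix

/-- A diagonal entry of `Tᴴ A T` is the value of the hermitian form with Gram matrix `A` on the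
corresponding column of `T`: `(Tᴴ A T)ᵢᵢ = t̄ᵢ ⬝ (A tᵢ)` (private helper). [folklore] -/
private theorem conjTranspose_mul_mul_apply_self {m : Type*} [Fintype m] (T A : Matrix m m ℂ) (i : m) :
    (Tᴴ * A * T) i i = star (fun l ↦ T l i) ⬝ᵥ (A *ᵥ fun l ↦ T l i) := by
  rw [Matrix.dotProduct_mulVec, Matrix.mul_apply']
  rfl

namespace UnitaryBallUniformisationDatum

variable (D : UnitaryBallUniformisationDatum p X)

/-- **The negative cone of `V_{τ₁}` is nonempty**: the last vector `t` of a Sylvester frame `T`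
(`Tᴴ H^{τ₁} T = diag(1, …, 1, -1)`, field `signature_τ₁`) has `⟪t, t⟫ = -1` (BMM Part 2 §1.1: `V_{v₀}`
has signature `(p, q)`; §1.3: `X` is the space of negative `q`-planes in `V_{v₀}`).
[cite: BergeronMillsonMoeglin2016Balls, Part 2 §§1.1, 1.3] -/
theorem cone_nonempty : D.cone.Nonempty := by
  obtain ⟨T, hT⟩ := D.signature_τ₁
  refine ⟨fun l ↦ (T : Matrix _ _ ℂ) l (Fin.last p), ?_⟩
  rw [mem_negCone_iff, ← conjTranspose_mul_mul_apply_self, hT, signatureMatrix,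
    Matrix.diagonal_apply_eq, if_pos rfl]
  norm_num

/-- `τ₁(E)` is dense in `ℂ`: `E` is CM, hence totally complex, so `τ₁` is a non-real embedding
(`Literature.LinearAlgebra.Matrix.dense_fieldRange_of_isTotallyComplex`; private helper). [folklore] -/
private theorem denseRange_τ₁ : DenseRange D.τ₁ := by
  have h := Literature.LinearAlgebra.Matrix.dense_fieldRange_of_isTotallyComplex D.τ₁
  rwa [RingHom.coe_fieldRange] at h

/-- **`V = E^{p+1}` contains a `τ₁`-negative vector**: some `v ∈ V` has `Re τ₁⟪v, v⟫ < 0` — the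
negative cone of `V_{τ₁}` is open (`isOpen_negCone`) and nonempty (`cone_nonempty`), and
`τ₁(E)^{p+1}` is dense in `ℂ^{p+1} = V_{τ₁}` (`denseRange_τ₁`).
[cite: BergeronMillsonMoeglin2016Balls, Part 2 §§1.1, 1.3] -/
theorem exists_re_hermForm_neg :
    ∃ v : Fin (p + 1) → D.E, (D.τ₁ (hermForm (conjRingHom D.E) D.H v v)).re < 0 := by
  have hd : DenseRange (Pi.map fun _ : Fin (p + 1) ↦ (D.τ₁ : D.E → ℂ)) :=
    DenseRange.piMap fun _ ↦ D.denseRange_τ₁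
  obtain ⟨v, hv⟩ := hd.exists_mem_open (isOpen_negCone D.Hℂ) D.cone_nonempty
  exact ⟨v, by rw [map_hermForm D.τ₁ (embedding_conjRingHom D.E D.τ₁) D.H v v]; exact hv⟩

/-- **A totally positive definite subspace of `V` has dimension at most `p`** (BMM Part 2 §3.1:
"as a sub-Hermitian space `U ⊂ V` is totally positive definite of dimension `t`. In particular:
`0 ≤ t ≤ p`"): the form has signature `(p, 1)` at `τ₁`, so `V = E^{p+1}` itself contains a
`τ₁`-negative vector (`exists_re_hermForm_neg`) and is not totally positive definite, while every
proper subspace has dimension `≤ p`. [cite: BergeronMillsonMoeglin2016Balls, Part 2 §3.1] -/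
theorem finrank_le_of_isTotallyPositive {W : Submodule D.E (Fin (p + 1) → D.E)}
    (hW : IsTotallyPositive (conjRingHom D.E) D.H W) : Module.finrank D.E W ≤ p := by
  by_contra h
  have htop : W = ⊤ := Submodule.eq_top_of_finrank_eq (le_antisymm (Submodule.finrank_le W) (by
    rw [Module.finrank_fin_fun]; omega))
  obtain ⟨v, hv⟩ := D.exists_re_hermForm_neg
  have hv0 : v ≠ 0 := by
    rintro rfl
    simp [hermForm] at hv
  have hpos := hW v (htop ▸ Submodule.mem_top) hv0 D.τ₁
  linarith

end UnitaryBallUniformisationDatum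

/-- **No special cycle classes above the signature bound**: `SC^{2k}(S) ⊗ ℂ = 0` for `k > p` — the
special cycles of codimension `k` (`q = 1`) are indexed by the totally positive definite `W ⊆ V` of
dimension `k`, and there are none of dimension `> p`
(`UnitaryBallUniformisationDatum.finrank_le_of_isTotallyPositive`), so the defining supremum is
over an empty family (BMM Introduction §1.7: `SC^•(S) = ⊕_{n=0}^{p} SC^{2nq}(S)`; Part 2 §3.1:
`0 ≤ t ≤ p`). [cite: BergeronMillsonMoeglin2016Balls, Introduction §1.7 and Part 2 §3.1] -/
theorem specialCycleClasses_eq_bot_of_lt (D : UnitaryBallQuotientDatum p X) {k : ℕ} (hk : p < k) :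
    specialCycleClasses D k = ⊥ := by
  refine eq_bot_iff.2 ((specialCycleClasses_le_iff D).2 fun W hW hWk ↦ ?_)
  have hle := D.finrank_le_of_isTotallyPositive hW
  omega

/-- **The ball-quotient surface case `p = 2`** (validation theorem V-C3.ii / V-C4.ii of the
lit-hodgefound Layer-C definitions tribunal, statement as in its probe file): a hermitian form of
signature `(2, 1)` has no totally positive definite subspace of dimension `≥ 3`, so
`SC^{2k}(S) ⊗ ℂ = 0` for every `k > 2` (`specialCycleClasses_eq_bot_of_lt` at `p = 2`).
[cite: BergeronMillsonMoeglin2016Balls, Introduction §1.7 and Part 2 §3.1] -/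
theorem specialCycleClasses_eq_bot_of_two_lt {X : SchemeOver ℂ} (D : UnitaryBallQuotientDatum 2 X)
    {k : ℕ} (hk : 2 < k) : specialCycleClasses D k = ⊥ :=
  specialCycleClasses_eq_bot_of_lt D hk

end Literature.AlgebraicGeometry.ShimuraVarieties

end
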